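import Summits.BirchSwinnertonDyer.BirchSwinnertonDyer.Theses.KatoDescentTamePotSupersingular
import HarnessLib

/-!
# Route `KatoDescentTamePotSupersingular` (rung K8, sub-rung B4 (t′), cell `bsd-potss`): the `Assembly`
# node — PROVED (item stmt-BirchSwinnertonDyer-19985)

`Assembly : TameLowerHalfRankZero → ReducibleKatoMember → TameUpperDefectRankZero → PublishedInputsTame →
TameRankZeroAssembly → TameRankOne → O5SharpTprime` is pure logic: for a (t′) pair of analytic rank
`≤ 1`, split `r_an = 0` — covered rows through the rank-`0` assembly support, defect rows through
L₀ (lower) + U₀ (upper) + `missingPPartAt_of_lower_of_upper` — and `r_an = 1` through the declared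
residual `TameRankOne`. Verbatim the argument inside the route's deciding theorem `closes`. Nothing about
the cruxes is asserted. Seat `bsd-potss-kmc` generation 6.
-/

set_option autoImplicit false
-- sibling precedent (`KatoDescentPotSupersingularAssembly.lean`): the directory name repeats the summit name
set_option linter.dupNamespace false

noncomputable section

open scoped Classical

namespace Summit.BirchSwinnertonDyer.BirchSwinnertonDyer.Theorems

open WeierstrassCurve Literature.NumberTheory.EllipticCurves
  Literature.NumberTheory.EllipticCurves.Rank1Residual.Typed
  Summit.BirchSwinnertonDyer.BirchSwinnertonDyer.Theses.KatoDescentTamePotSupersingular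

/-- **The K8(t′) `Assembly` node, proved** (route `KatoDescentTamePotSupersingular`, item
stmt-BirchSwinnertonDyer-19985): case split `r_an = 0` (covered / defect rows) vs `r_an = 1`
(residual). [cite: Kato2004Asterisque, Thm. 14.5 (3) (p. 236)] [cite: Miller2011LMS, §1 and Def. 1.1] -/
theorem katoDescentTamePotSupersingular_assembly_proof :
    Summit.BirchSwinnertonDyer.BirchSwinnertonDyer.Theses.KatoDescentTamePotSupersingular.Assembly := by
  intro h₂ h₃ h₄ hP hA hR W _ _ p hp hr hp2 hadd hT
  rcases Nat.le_one_iff_eq_zero_or_eq_one.mp hr with h0 | h1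
  · by_cases hcov :
        ((∀ n : ℕ, W.HasSurjectiveModNGaloisRep (p ^ n : ℕ)) ∧ ¬ p ∣ W.tamagawaProduct ∧
            ∃ (N : ℕ) (_ : NeZero N)
              (D : Literature.NumberTheory.EllipticCurves.ModularForms.ModularParametrizationData W N),
              ¬ (p : ℤ) ∣ D.maninConstant) ∨
          (¬ W.HasIrreducibleModPGaloisRep p ∧
            (∀ (W' : WeierstrassCurve ℚ) [W'.IsElliptic],
                WeierstrassCurve.IsIsogenous W W' → ¬ p ^ 2 ∣ W'.torsionOrder) ∧
            ∀ q : ℚ, Literature.NumberTheory.EllipticCurves.shaAn W = (q : ℂ) → Even (padicValRat p q))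
    · exact hA h₂ h₃ hP W p h0 hp2 hadd hT hcov
    · exact missingPPartAt_of_lower_of_upper W p (h₂ W p h0 hp2 hadd hT) (h₄ W p h0 hp2 hadd hT hcov)
  · exact hR W p h1 hp2 hadd hT

end Summit.BirchSwinnertonDyer.BirchSwinnertonDyer.Theorems

end
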